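import Summits.QuantumFields.YangMills.Theorems.AllWindowsColdBoxBoxHighLineSmearedFPOperatorExpansion
import Summits.QuantumFields.YangMills.Theorems.AllWindowsColdBoxBoxHighLineLandauBallSums

/-!
# TASK T-S5/U5 step (1b), brick 4c-E: PERTURBATION of the Faddeev–Popov operator, `E(U) = fpOperator H U − fpOperator H 1`

Planner ym-idea-2 g17's T-S5.4 brick table; requested by the ℓ²-floor consumer (w4 g27, ✓`…SpectralFloorTools.opFloor_add`, hypothesis
`∀ v, (E *ᵥ v) ⬝ᵥ (E *ᵥ v) ≤ m² · (v ⬝ᵥ v)`) and by the T-S5.4 assembly (invertibility / `det` control of `fpOperator H U` near the flat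
point `fpOperator H 1 = −(Δ_I ⊗ₖ pauliPerm)`, ✓`fpOperator_one`).  For a configuration whose cold-box links satisfy `‖↑(U e) − 1‖ ≤ δ`
(ℓ∞-operator norm of ✓`…QuantumBCH`; `δ = 3r` on the `r`-ball, `norm_coe_sub_one_le_of_linkDefect`):

* `pauliLinkLin_sub` / `pauliLinkLin_sub_one` : `pauliLinkLin W a e − pauliLinkLin W' a e = X_{e₋}·(W_e − W'_e) − (W_e − W'_e)·X_{e₊}`,
  norm `≤ 3δ(‖a e₋‖ + ‖a e₊‖)` (TWO configurations: the Lipschitz input of T-S5.4J's J2 `OrbitMapContraction`);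
* `abs_divDefectLin_sub_le` / `_sub_one_le` : `|divDefectLin W a x c − divDefectLin W' a x c| ≤ 3δ·Σ_μ (‖a(x−e_μ)‖ + ‖a(x+e_μ)‖ + 2‖a x‖)`;
* **`fpOperator_sub_opBound`** (two configurations) / `fpOperator_sub_one_opBound` : `((fpOperator H W − fpOperator H W') *ᵥ v) ⬝ᵥ (same) ≤ (84·δ)² · (v ⬝ᵥ v)`
  (Cauchy–Schwarz per site + the edge-multiplicity count ✓`LandauBall.sum_edges_endpoints_le`: every site is an endpoint of ≤ 8 box links);
* `norm_coe_sub_one_le_of_linkDefect` : `linkDefect U e ≤ r²`, `r ≤ 1` ⇒ `‖↑(U e) − 1‖ ≤ 3r`, and the `r`-ball corollary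
  `fpOperator_sub_one_opBound_of_linkDefect` (`m = 252·r`).

So on S4b's Landau representative (`r ≍ H²(1+log H)²·s`) the FP operator is an ℓ²-small perturbation of `−Δ_I ⊗ pauliPerm` as soon as
`r ≪ λ_min(Δ_I) ≍ H⁻²`.  HONEST LABEL: one brick of step (1b) of the XL stubs S5/U5; T-S5.4 proper, S5, U5, ⟨24004⟩ ⟨24335⟩ ⟨24336⟩ remain
OPEN; no crux, rung or summit is proved; the Yang–Mills mass gap is NOT proved by this file.
-/

set_option autoImplicit false

noncomputable section

open Matrix Finset
open scoped Matrix.Norms.Operator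
open Literature.MathematicalPhysics.QuantumFieldTheory.Balaban1983to89.B10Eq18SigmaSU2 (su2Coord)
open Literature.MathematicalPhysics.QuantumFieldTheory.AxialGauge (boxEdges)
open Literature.MathematicalPhysics.QuantumLattice (LGConfig ZdEdge gaugeTransformZd)
open Literature.Probability.LatticeModels (Site)
open Summit.QuantumFields.YangMills.Theorems.AllWindowsColdBoxBoxHighLine.LandauBall

namespace Summit.QuantumFields.YangMills.Theorems.AllWindowsColdBoxBoxHighLine

/-! ## Per link -/

/-- Two configurations: `pauliLinkLin W a e − pauliLinkLin W' a e = X_{e₋}·(W_e − W'_e) − (W_e − W'_e)·X_{e₊}` (`F` is ℝ-linear in the links). -/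
theorem pauliLinkLin_sub (W W' : LGConfig 4 SU2) (a : Site 4 → EuclideanSpace ℝ (Fin 3)) (e : ZdEdge 4) :
    pauliLinkLin W a e - pauliLinkLin W' a e =
      su2Coord (a e.1) * ((W e : Matrix (Fin 2) (Fin 2) ℂ) - (W' e : Matrix (Fin 2) (Fin 2) ℂ)) -
        ((W e : Matrix (Fin 2) (Fin 2) ℂ) - (W' e : Matrix (Fin 2) (Fin 2) ℂ)) * su2Coord (a (e.1 + Pi.single e.2 1)) := by
  simp only [pauliLinkLin, mul_sub, sub_mul]
  abel

/-- `pauliLinkLin U a e − pauliLinkLin 1 a e = X_{e₋}·(U_e − 1) − (U_e − 1)·X_{e₊}`. -/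
theorem pauliLinkLin_sub_one (U : LGConfig 4 SU2) (a : Site 4 → EuclideanSpace ℝ (Fin 3)) (e : ZdEdge 4) :
    pauliLinkLin U a e - pauliLinkLin 1 a e =
      su2Coord (a e.1) * ((U e : Matrix (Fin 2) (Fin 2) ℂ) - 1) - ((U e : Matrix (Fin 2) (Fin 2) ℂ) - 1) * su2Coord (a (e.1 + Pi.single e.2 1)) := by
  rw [pauliLinkLin_sub]; simp

/-- Norm of the link perturbation between two configurations: `≤ 3δ(‖a e₋‖ + ‖a e₊‖)` when `‖W_e − W'_e‖ ≤ δ`. -/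
theorem norm_pauliLinkLin_sub_le (W W' : LGConfig 4 SU2) (a : Site 4 → EuclideanSpace ℝ (Fin 3)) (e : ZdEdge 4) {δ : ℝ}
    (hU : ‖(W e : Matrix (Fin 2) (Fin 2) ℂ) - (W' e : Matrix (Fin 2) (Fin 2) ℂ)‖ ≤ δ) :
    ‖pauliLinkLin W a e - pauliLinkLin W' a e‖ ≤ 3 * δ * (‖a e.1‖ + ‖a (e.1 + Pi.single e.2 1)‖) := by
  have hδ : 0 ≤ δ := (norm_nonneg _).trans hU
  rw [pauliLinkLin_sub]
  calc _ ≤ ‖su2Coord (a e.1) * ((W e : Matrix (Fin 2) (Fin 2) ℂ) - (W' e : Matrix (Fin 2) (Fin 2) ℂ))‖ +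
        ‖((W e : Matrix (Fin 2) (Fin 2) ℂ) - (W' e : Matrix (Fin 2) (Fin 2) ℂ)) * su2Coord (a (e.1 + Pi.single e.2 1))‖ := norm_sub_le _ _
    _ ≤ 3 * ‖a e.1‖ * δ + δ * (3 * ‖a (e.1 + Pi.single e.2 1)‖) :=
        add_le_add ((norm_mul_le _ _).trans (mul_le_mul (Parity.norm_su2Coord_le _) hU (norm_nonneg _) (by positivity)))
          ((norm_mul_le _ _).trans (mul_le_mul hU (Parity.norm_su2Coord_le _) (norm_nonneg _) hδ))
    _ = 3 * δ * (‖a e.1‖ + ‖a (e.1 + Pi.single e.2 1)‖) := by ring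

/-- The one-configuration form (`W' = 1`). -/
theorem norm_pauliLinkLin_sub_one_le (U : LGConfig 4 SU2) (a : Site 4 → EuclideanSpace ℝ (Fin 3)) (e : ZdEdge 4) {δ : ℝ}
    (hU : ‖(U e : Matrix (Fin 2) (Fin 2) ℂ) - 1‖ ≤ δ) :
    ‖pauliLinkLin U a e - pauliLinkLin 1 a e‖ ≤ 3 * δ * (‖a e.1‖ + ‖a (e.1 + Pi.single e.2 1)‖) :=
  norm_pauliLinkLin_sub_le U 1 a e (by simpa using hU)

/-! ## Per site -/

/-- **Perturbation of the linearised divergence defect** at an interior site, two configurations: with `‖W_e − W'_e‖ ≤ δ` on the cold-box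
links, `|divDefectLin W a x c − divDefectLin W' a x c| ≤ 3δ · Σ_μ (‖a(x−e_μ)‖ + ‖a(x+e_μ)‖ + 2‖a x‖)`. -/
theorem abs_divDefectLin_sub_le {H : ℕ} (W W' : LGConfig 4 SU2) (a : Site 4 → EuclideanSpace ℝ (Fin 3)) {x : Site 4}
    (hx : x ∈ interiorSites H) {δ : ℝ}
    (hU : ∀ e ∈ boxEdges 4 (2 * H + 1), ‖(W e : Matrix (Fin 2) (Fin 2) ℂ) - (W' e : Matrix (Fin 2) (Fin 2) ℂ)‖ ≤ δ) (c : Fin 3) :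
    |divDefectLin W a x c - divDefectLin W' a x c| ≤
      3 * δ * ∑ μ : Fin 4, (‖a (x - Pi.single μ 1)‖ + ‖a (x + Pi.single μ 1)‖ + 2 * ‖a x‖) := by
  rw [divDefectLin_apply, divDefectLin_apply, ← Finset.sum_sub_distrib, Finset.mul_sum]
  refine (Finset.abs_sum_le_sum_abs _ _).trans (Finset.sum_le_sum fun μ _ => ?_)
  have hin := norm_pauliLinkLin_sub_le W W' a (x - Pi.single μ 1, μ) (hU _ (in_mem_boxEdges hx μ))
  have hout := norm_pauliLinkLin_sub_le W W' a (x, μ) (hU _ (out_mem_boxEdges hx μ))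
  dsimp only at hin hout
  rw [sub_add_cancel] at hin
  have h1 : |imVecM (pauliLinkLin W a (x - Pi.single μ 1, μ)) c - imVecM (pauliLinkLin W' a (x - Pi.single μ 1, μ)) c| ≤
      3 * δ * (‖a (x - Pi.single μ 1)‖ + ‖a x‖) := by
    rw [← Pi.sub_apply, ← imVecM_sub]; exact (abs_imVecM_le_norm _ c).trans hin
  have h2 : |imVecM (pauliLinkLin W a (x, μ)) c - imVecM (pauliLinkLin W' a (x, μ)) c| ≤ 3 * δ * (‖a x‖ + ‖a (x + Pi.single μ 1)‖) := by
    rw [← Pi.sub_apply, ← imVecM_sub]; exact (abs_imVecM_le_norm _ c).trans hout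
  have hrw : imVecM (pauliLinkLin W a (x - Pi.single μ 1, μ)) c - imVecM (pauliLinkLin W a (x, μ)) c -
      (imVecM (pauliLinkLin W' a (x - Pi.single μ 1, μ)) c - imVecM (pauliLinkLin W' a (x, μ)) c) =
      (imVecM (pauliLinkLin W a (x - Pi.single μ 1, μ)) c - imVecM (pauliLinkLin W' a (x - Pi.single μ 1, μ)) c) -
        (imVecM (pauliLinkLin W a (x, μ)) c - imVecM (pauliLinkLin W' a (x, μ)) c) := by ring
  rw [hrw]
  calc _ ≤ 3 * δ * (‖a (x - Pi.single μ 1)‖ + ‖a x‖) + 3 * δ * (‖a x‖ + ‖a (x + Pi.single μ 1)‖) :=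
        (abs_sub _ _).trans (add_le_add h1 h2)
    _ = 3 * δ * (‖a (x - Pi.single μ 1)‖ + ‖a (x + Pi.single μ 1)‖ + 2 * ‖a x‖) := by ring

/-- The one-configuration form (`W' = 1`). -/
theorem abs_divDefectLin_sub_one_le {H : ℕ} (U : LGConfig 4 SU2) (a : Site 4 → EuclideanSpace ℝ (Fin 3)) {x : Site 4}
    (hx : x ∈ interiorSites H) {δ : ℝ} (hU : ∀ e ∈ boxEdges 4 (2 * H + 1), ‖(U e : Matrix (Fin 2) (Fin 2) ℂ) - 1‖ ≤ δ) (c : Fin 3) :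
    |divDefectLin U a x c - divDefectLin 1 a x c| ≤
      3 * δ * ∑ μ : Fin 4, (‖a (x - Pi.single μ 1)‖ + ‖a (x + Pi.single μ 1)‖ + 2 * ‖a x‖) :=
  abs_divDefectLin_sub_le U 1 a hx (fun e he => by simpa using hU e he) c

/-- Cauchy–Schwarz for the sixteen-term site sum: `(Σ_μ (p_μ + q_μ + 2r))² ≤ 16 · Σ_μ (p_μ² + q_μ² + 2r²)`. -/
theorem sq_sum_four_le (p q : Fin 4 → ℝ) (r : ℝ) :
    (∑ μ : Fin 4, (p μ + q μ + 2 * r)) ^ 2 ≤ 16 * ∑ μ : Fin 4, (p μ ^ 2 + q μ ^ 2 + 2 * r ^ 2) := by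
  have step : ∀ μ : Fin 4, (p μ + q μ + 2 * r) ^ 2 ≤ 4 * (p μ ^ 2 + q μ ^ 2 + 2 * r ^ 2) := fun μ => by
    nlinarith [sq_nonneg (p μ - q μ), sq_nonneg (p μ - r), sq_nonneg (q μ - r)]
  have cs : ∀ s : Fin 4 → ℝ, (∑ μ : Fin 4, s μ) ^ 2 ≤ 4 * ∑ μ : Fin 4, s μ ^ 2 := fun s => by
    simp only [Fin.sum_univ_four]
    nlinarith [sq_nonneg (s 0 - s 1), sq_nonneg (s 0 - s 2), sq_nonneg (s 0 - s 3), sq_nonneg (s 1 - s 2), sq_nonneg (s 1 - s 3),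
      sq_nonneg (s 2 - s 3)]
  calc (∑ μ : Fin 4, (p μ + q μ + 2 * r)) ^ 2 ≤ 4 * ∑ μ : Fin 4, (p μ + q μ + 2 * r) ^ 2 := cs _
    _ ≤ 4 * ∑ μ : Fin 4, 4 * (p μ ^ 2 + q μ ^ 2 + 2 * r ^ 2) :=
        mul_le_mul_of_nonneg_left (Finset.sum_le_sum fun μ _ => step μ) (by norm_num)
    _ = 16 * ∑ μ : Fin 4, (p μ ^ 2 + q μ ^ 2 + 2 * r ^ 2) := by rw [← Finset.mul_sum]; ring

/-! ## The ℓ² operator bound -/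

/-- Neighbour-sum bookkeeping: for `f ≥ 0` vanishing off the interior,
`Σ_{x interior} Σ_μ (f(x−e_μ) + f(x+e_μ) + 2 f(x)) ≤ 16 · Σ_{x interior} f(x)`. -/
theorem sum_interior_neighbours_le {H : ℕ} (f : Site 4 → ℝ) (hf0 : ∀ x, 0 ≤ f x) (hf : ∀ x, x ∉ interiorSites H → f x = 0) :
    ∑ x ∈ interiorSites H, ∑ μ : Fin 4, (f (x - Pi.single μ 1) + f (x + Pi.single μ 1) + 2 * f x) ≤ 16 * ∑ x ∈ interiorSites H, f x := by
  classical
  -- out-edges: Σ_x Σ_μ (f x + f (x + e_μ)) as a sum over box edges with interior base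
  have hout := sum_edges_eq_sum_interior_out (H := H)
    (fun e => if e.1 ∈ interiorSites H then f e.1 + f (e.1 + Pi.single e.2 1) else 0) (fun e he => if_neg he)
  have hin := sum_edges_eq_sum_interior_in (H := H)
    (fun e => if e.1 + Pi.single e.2 1 ∈ interiorSites H then f e.1 + f (e.1 + Pi.single e.2 1) else 0) (fun e he => if_neg he)
  have hout' : ∑ x ∈ interiorSites H, ∑ μ : Fin 4, (f x + f (x + Pi.single μ 1)) ≤
      ∑ e ∈ boxEdges 4 (2 * H + 1), (f e.1 + f (e.1 + Pi.single e.2 1)) := by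
    have : ∑ x ∈ interiorSites H, ∑ μ : Fin 4, (f x + f (x + Pi.single μ 1)) =
        ∑ x ∈ interiorSites H, ∑ μ : Fin 4, (if (x, μ).1 ∈ interiorSites H then f (x, μ).1 + f ((x, μ).1 + Pi.single (x, μ).2 1) else 0) :=
      Finset.sum_congr rfl fun x hx => Finset.sum_congr rfl fun μ _ => by rw [if_pos hx]
    rw [this, ← hout]
    exact Finset.sum_le_sum fun e _ => by
      split_ifs
      · exact le_rfl
      · exact add_nonneg (hf0 _) (hf0 _)
  have hin' : ∑ x ∈ interiorSites H, ∑ μ : Fin 4, (f (x - Pi.single μ 1) + f x) ≤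
      ∑ e ∈ boxEdges 4 (2 * H + 1), (f e.1 + f (e.1 + Pi.single e.2 1)) := by
    have : ∑ x ∈ interiorSites H, ∑ μ : Fin 4, (f (x - Pi.single μ 1) + f x) =
        ∑ x ∈ interiorSites H, ∑ μ : Fin 4, (if (x - Pi.single μ 1, μ).1 + Pi.single (x - Pi.single μ 1, μ).2 1 ∈ interiorSites H then
          f (x - Pi.single μ 1, μ).1 + f ((x - Pi.single μ 1, μ).1 + Pi.single (x - Pi.single μ 1, μ).2 1) else 0) :=
      Finset.sum_congr rfl fun x hx => Finset.sum_congr rfl fun μ _ => by simp only [sub_add_cancel]; rw [if_pos hx]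
    rw [this, ← hin]
    exact Finset.sum_le_sum fun e _ => by
      split_ifs
      · exact le_rfl
      · exact add_nonneg (hf0 _) (hf0 _)
  have hmult := sum_edges_endpoints_le (H := H) f hf0 hf
  have hsplit : ∑ x ∈ interiorSites H, ∑ μ : Fin 4, (f (x - Pi.single μ 1) + f (x + Pi.single μ 1) + 2 * f x) =
      ∑ x ∈ interiorSites H, ∑ μ : Fin 4, (f (x - Pi.single μ 1) + f x) + ∑ x ∈ interiorSites H, ∑ μ : Fin 4, (f x + f (x + Pi.single μ 1)) := by
    rw [← Finset.sum_add_distrib]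
    refine Finset.sum_congr rfl fun x _ => ?_
    rw [← Finset.sum_add_distrib]
    exact Finset.sum_congr rfl fun μ _ => by ring
  rw [hsplit]
  linarith

/-- The squared norm of the interior field of a coordinate vector is `v ⬝ᵥ v`. -/
theorem sum_norm_sq_extPauli_vecToField {H : ℕ} (v : ↥(interiorSites H) × Fin 3 → ℝ) :
    ∑ x ∈ interiorSites H, ‖extPauli H (vecToField H v) x‖ ^ 2 = v ⬝ᵥ v := by
  rw [← Finset.sum_coe_sort (interiorSites H), dotProduct, Fintype.sum_prod_type]
  refine Finset.sum_congr rfl fun y _ => ?_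
  rw [extPauli_of_mem _ y.2, EuclideanSpace.norm_sq_eq]
  exact Finset.sum_congr rfl fun b _ => by rw [Real.norm_eq_abs, sq_abs, sq]; rfl

/-- **THE ℓ² PERTURBATION BOUND, two configurations** (also the Lipschitz input of T-S5.4J's J2): if every cold-box link satisfies
`‖↑(W e) − ↑(W' e)‖ ≤ δ`, then `E = fpOperator H W − fpOperator H W'` obeys `(E *ᵥ v) ⬝ᵥ (E *ᵥ v) ≤ (84·δ)² · (v ⬝ᵥ v)` for every `v`. -/
theorem fpOperator_sub_opBound {H : ℕ} (W W' : LGConfig 4 SU2) {δ : ℝ}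
    (hU : ∀ e ∈ boxEdges 4 (2 * H + 1), ‖(W e : Matrix (Fin 2) (Fin 2) ℂ) - (W' e : Matrix (Fin 2) (Fin 2) ℂ)‖ ≤ δ)
    (v : ↥(interiorSites H) × Fin 3 → ℝ) :
    ((fpOperator H W - fpOperator H W') *ᵥ v) ⬝ᵥ ((fpOperator H W - fpOperator H W') *ᵥ v) ≤ (84 * δ) ^ 2 * (v ⬝ᵥ v) := by
  set a : Site 4 → EuclideanSpace ℝ (Fin 3) := extPauli H (vecToField H v) with ha
  set f : Site 4 → ℝ := fun z => ‖a z‖ ^ 2 with hf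
  have hf0 : ∀ z, 0 ≤ f z := fun z => sq_nonneg _
  have hfI : ∀ z, z ∉ interiorSites H → f z = 0 := fun z hz => by simp only [hf, ha, extPauli_of_not_mem _ hz, norm_zero]; ring
  -- pointwise bound on the entries of `E v`
  have hpt : ∀ p : ↥(interiorSites H) × Fin 3, (((fpOperator H W - fpOperator H W') *ᵥ v) p) ^ 2 ≤
      9 * δ ^ 2 * (16 * ∑ μ : Fin 4, (f ((p.1 : Site 4) - Pi.single μ 1) + f ((p.1 : Site 4) + Pi.single μ 1) + 2 * f p.1)) := by
    intro p
    rw [Matrix.sub_mulVec, Pi.sub_apply, fpOperator_mulVec, fpOperator_mulVec]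
    have h1 := abs_divDefectLin_sub_le W W' a p.1.2 hU p.2
    have h2 := sq_sum_four_le (fun μ => ‖a ((p.1 : Site 4) - Pi.single μ 1)‖) (fun μ => ‖a ((p.1 : Site 4) + Pi.single μ 1)‖)
      ‖a (p.1 : Site 4)‖
    have h3 : (divDefectLin W a p.1 p.2 - divDefectLin W' a p.1 p.2) ^ 2 ≤
        (3 * δ * ∑ μ : Fin 4, (‖a ((p.1 : Site 4) - Pi.single μ 1)‖ + ‖a ((p.1 : Site 4) + Pi.single μ 1)‖ + 2 * ‖a (p.1 : Site 4)‖)) ^ 2 := by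
      rw [← sq_abs]; exact pow_le_pow_left₀ (abs_nonneg _) h1 2
    calc _ ≤ (3 * δ * ∑ μ : Fin 4, (‖a ((p.1 : Site 4) - Pi.single μ 1)‖ + ‖a ((p.1 : Site 4) + Pi.single μ 1)‖ + 2 * ‖a (p.1 : Site 4)‖)) ^ 2 := h3
      _ = 9 * δ ^ 2 * (∑ μ : Fin 4, (‖a ((p.1 : Site 4) - Pi.single μ 1)‖ + ‖a ((p.1 : Site 4) + Pi.single μ 1)‖ + 2 * ‖a (p.1 : Site 4)‖)) ^ 2 := by
          ring
      _ ≤ 9 * δ ^ 2 * (16 * ∑ μ : Fin 4, (f ((p.1 : Site 4) - Pi.single μ 1) + f ((p.1 : Site 4) + Pi.single μ 1) + 2 * f p.1)) :=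
          mul_le_mul_of_nonneg_left h2 (by positivity)
  -- sum over `(x, c)`
  have hsum : ((fpOperator H W - fpOperator H W') *ᵥ v) ⬝ᵥ ((fpOperator H W - fpOperator H W') *ᵥ v) ≤
      9 * δ ^ 2 * (16 * (3 * ∑ x ∈ interiorSites H, ∑ μ : Fin 4, (f (x - Pi.single μ 1) + f (x + Pi.single μ 1) + 2 * f x))) := by
    rw [dotProduct]
    calc ∑ p, ((fpOperator H W - fpOperator H W') *ᵥ v) p * ((fpOperator H W - fpOperator H W') *ᵥ v) p
        ≤ ∑ p : ↥(interiorSites H) × Fin 3,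
            9 * δ ^ 2 * (16 * ∑ μ : Fin 4, (f ((p.1 : Site 4) - Pi.single μ 1) + f ((p.1 : Site 4) + Pi.single μ 1) + 2 * f p.1)) :=
          Finset.sum_le_sum fun p _ => by rw [← sq]; exact hpt p
      _ = ∑ y : ↥(interiorSites H), 3 * (9 * δ ^ 2 * (16 * ∑ μ : Fin 4,
            (f ((y : Site 4) - Pi.single μ 1) + f ((y : Site 4) + Pi.single μ 1) + 2 * f y))) := by
          rw [Fintype.sum_prod_type]
          refine Finset.sum_congr rfl fun y _ => ?_
          simp only [Finset.sum_const, Finset.card_univ, Fintype.card_fin]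
          ring
      _ = 9 * δ ^ 2 * (16 * (3 * ∑ x ∈ interiorSites H, ∑ μ : Fin 4, (f (x - Pi.single μ 1) + f (x + Pi.single μ 1) + 2 * f x))) := by
          rw [← Finset.sum_coe_sort (interiorSites H), Finset.mul_sum, Finset.mul_sum, Finset.mul_sum]
          refine Finset.sum_congr rfl fun y _ => ?_
          ring
  have hnb := sum_interior_neighbours_le (H := H) f hf0 hfI
  have hvv : ∑ x ∈ interiorSites H, f x = v ⬝ᵥ v := sum_norm_sq_extPauli_vecToField v
  rw [hvv] at hnb
  have hvv0 : 0 ≤ v ⬝ᵥ v := by rw [← hvv]; exact Finset.sum_nonneg fun z _ => hf0 z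
  nlinarith [hsum, hnb, sq_nonneg δ]

/-- The one-configuration form (`W' = 1`): the hypothesis `hE` of ✓`SpectralFloor.opFloor_add` with `m = 84δ`. -/
theorem fpOperator_sub_one_opBound {H : ℕ} (U : LGConfig 4 SU2) {δ : ℝ}
    (hU : ∀ e ∈ boxEdges 4 (2 * H + 1), ‖(U e : Matrix (Fin 2) (Fin 2) ℂ) - 1‖ ≤ δ) (v : ↥(interiorSites H) × Fin 3 → ℝ) :
    ((fpOperator H U - fpOperator H 1) *ᵥ v) ⬝ᵥ ((fpOperator H U - fpOperator H 1) *ᵥ v) ≤ (84 * δ) ^ 2 * (v ⬝ᵥ v) :=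
  fpOperator_sub_opBound U 1 (fun e he => by simpa using hU e he) v

/-! ## From link defects to `δ` -/

/-- **Link dictionary**: a link of defect `≤ r²` (`r ≤ 1`) is `3r`-close to the identity in the ℓ∞-operator norm
(`W = [[α, −β̄],[β, ᾱ]]`: `1 − Re α = r_e²/2 ≤ r²/2`, `|Im α|, |β| ≤ r`). -/
theorem norm_coe_sub_one_le_of_linkDefect (U : LGConfig 4 SU2) (e : ZdEdge 4) {r : ℝ} (hr0 : 0 ≤ r) (hr1 : r ≤ 1)
    (h : linkDefect U e ≤ r ^ 2) : ‖(U e : Matrix (Fin 2) (Fin 2) ℂ) - 1‖ ≤ 3 * r := by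
  have hdef : linkDefect U e = 2 - 2 * (((U e : SU2) : Matrix (Fin 2) (Fin 2) ℂ) 0 0).re := by rw [linkDefect_eq, trace_re_eq]
  have hre1 : (((U e : SU2) : Matrix (Fin 2) (Fin 2) ℂ) 0 0).re ≤ 1 := (abs_le.mp (abs_re_apply_zero_zero_le_one (U e))).2
  have hre0 : -1 ≤ (((U e : SU2) : Matrix (Fin 2) (Fin 2) ℂ) 0 0).re := (abs_le.mp (abs_re_apply_zero_zero_le_one (U e))).1
  have hcost : 1 - (((U e : SU2) : Matrix (Fin 2) (Fin 2) ℂ) 0 0).re ≤ r ^ 2 / 2 := by rw [hdef] at h; linarith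
  have hr2 : r ^ 2 ≤ r := by nlinarith
  have hsq := re_sq_add_sum_imVec_sq (U e)
  simp only [imVec, Fin.sum_univ_three, Matrix.cons_val_zero, Matrix.cons_val_one, Matrix.cons_val_two, Matrix.head_cons,
    Matrix.tail_cons] at hsq
  have hvec : (((U e : SU2) : Matrix (Fin 2) (Fin 2) ℂ) 0 0).im ^ 2 + (((U e : SU2) : Matrix (Fin 2) (Fin 2) ℂ) 1 0).re ^ 2 +
      (((U e : SU2) : Matrix (Fin 2) (Fin 2) ℂ) 1 0).im ^ 2 ≤ r ^ 2 := by nlinarith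
  have hre10 : 0 ≤ (((U e : SU2) : Matrix (Fin 2) (Fin 2) ℂ) 1 0).re ^ 2 := sq_nonneg _
  have him10 : 0 ≤ (((U e : SU2) : Matrix (Fin 2) (Fin 2) ℂ) 1 0).im ^ 2 := sq_nonneg _
  have him00 : 0 ≤ (((U e : SU2) : Matrix (Fin 2) (Fin 2) ℂ) 0 0).im ^ 2 := sq_nonneg _
  have him2 : (((U e : SU2) : Matrix (Fin 2) (Fin 2) ℂ) 0 0).im ^ 2 ≤ r ^ 2 := by linarith
  have him : |(((U e : SU2) : Matrix (Fin 2) (Fin 2) ℂ) 0 0).im| ≤ r := abs_le.2 (abs_le_of_sq_le_sq' him2 hr0)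
  have h10 : ‖((U e : SU2) : Matrix (Fin 2) (Fin 2) ℂ) 1 0‖ ≤ r := by
    have h2 : ‖((U e : SU2) : Matrix (Fin 2) (Fin 2) ℂ) 1 0‖ ^ 2 ≤ r ^ 2 := by
      rw [Complex.sq_norm, Complex.normSq_apply]; nlinarith
    exact (sq_le_sq₀ (norm_nonneg _) hr0).1 h2
  have h00 : ‖((U e : SU2) : Matrix (Fin 2) (Fin 2) ℂ) 0 0 - 1‖ ≤ r ^ 2 / 2 + r := by
    have h1 := Complex.norm_le_abs_re_add_abs_im (((U e : SU2) : Matrix (Fin 2) (Fin 2) ℂ) 0 0 - 1)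
    simp only [Complex.sub_re, Complex.one_re, Complex.sub_im, Complex.one_im, sub_zero] at h1
    have h2 : |(((U e : SU2) : Matrix (Fin 2) (Fin 2) ℂ) 0 0).re - 1| = 1 - (((U e : SU2) : Matrix (Fin 2) (Fin 2) ℂ) 0 0).re := by
      rw [abs_sub_comm]; exact abs_of_nonneg (by linarith)
    linarith
  -- the four entries of `U_e − 1`
  have e00 : (((U e : SU2) : Matrix (Fin 2) (Fin 2) ℂ) - 1) 0 0 = ((U e : SU2) : Matrix (Fin 2) (Fin 2) ℂ) 0 0 - 1 := by
    rw [Matrix.sub_apply, Matrix.one_apply_eq]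
  have e01 : (((U e : SU2) : Matrix (Fin 2) (Fin 2) ℂ) - 1) 0 1 = -(starRingEnd ℂ) (((U e : SU2) : Matrix (Fin 2) (Fin 2) ℂ) 1 0) := by
    rw [Matrix.sub_apply, Matrix.one_apply_ne (by decide), sub_zero, apply_zero_one_eq_neg_conj]
  have e10 : (((U e : SU2) : Matrix (Fin 2) (Fin 2) ℂ) - 1) 1 0 = ((U e : SU2) : Matrix (Fin 2) (Fin 2) ℂ) 1 0 := by
    rw [Matrix.sub_apply, Matrix.one_apply_ne (by decide), sub_zero]
  have e11 : (((U e : SU2) : Matrix (Fin 2) (Fin 2) ℂ) - 1) 1 1 = (starRingEnd ℂ) (((U e : SU2) : Matrix (Fin 2) (Fin 2) ℂ) 0 0 - 1) := by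
    rw [Matrix.sub_apply, Matrix.one_apply_eq, Literature.MathematicalPhysics.QuantumLattice.su2_apply_11, map_sub, map_one]
  refine linfty_opNorm_le_of_rows (by positivity) fun i => ?_
  fin_cases i
  · show ‖(((U e : SU2) : Matrix (Fin 2) (Fin 2) ℂ) - 1) 0 0‖ + ‖(((U e : SU2) : Matrix (Fin 2) (Fin 2) ℂ) - 1) 0 1‖ ≤ 3 * r
    rw [e00, e01, norm_neg, Complex.norm_conj]
    linarith
  · show ‖(((U e : SU2) : Matrix (Fin 2) (Fin 2) ℂ) - 1) 1 0‖ + ‖(((U e : SU2) : Matrix (Fin 2) (Fin 2) ℂ) - 1) 1 1‖ ≤ 3 * r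
    rw [e10, e11, Complex.norm_conj]
    linarith

/-- **The `r`-ball corollary**: if every cold-box link of `U` has defect `≤ r²` (`r ≤ 1`), then
`((fpOperator H U − fpOperator H 1) *ᵥ v) ⬝ᵥ (same) ≤ (252·r)² · (v ⬝ᵥ v)`. -/
theorem fpOperator_sub_one_opBound_of_linkDefect {H : ℕ} (U : LGConfig 4 SU2) {r : ℝ} (hr0 : 0 ≤ r) (hr1 : r ≤ 1)
    (hU : ∀ e ∈ boxEdges 4 (2 * H + 1), linkDefect U e ≤ r ^ 2) (v : ↥(interiorSites H) × Fin 3 → ℝ) :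
    ((fpOperator H U - fpOperator H 1) *ᵥ v) ⬝ᵥ ((fpOperator H U - fpOperator H 1) *ᵥ v) ≤ (252 * r) ^ 2 * (v ⬝ᵥ v) := by
  have h := fpOperator_sub_one_opBound U (fun e he => norm_coe_sub_one_le_of_linkDefect U e hr0 hr1 (hU e he)) v
  calc _ ≤ (84 * (3 * r)) ^ 2 * (v ⬝ᵥ v) := h
    _ = (252 * r) ^ 2 * (v ⬝ᵥ v) := by ring

end Summit.QuantumFields.YangMills.Theorems.AllWindowsColdBoxBoxHighLine

end
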